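import Summits.BirchSwinnertonDyer.Rank1Residual.P2.CongruentNumberPairsAtTwoRankOneGenus
import Literature.NumberTheory.EllipticCurves.FaulknerJames2007.RhoIndexEvenPartitionBound
import Literature.NumberTheory.EllipticCurves.CongruentNumberCurveTorsionProofs
import Literature.NumberTheory.EllipticCurves.CongruentNumberCurveTamagawaProofs
import HarnessLib

/-!
# Sub-lane «bsd-p2»: the PRIME FAMILY `q ≡ 7 (mod 8)` — `BSD(E_q, 2)` for EVERY prime `q ≡ 7 (mod 8)`
# as ONE uniform theorem, the rank-one datum supplied by Tian–Yuan–Zhang's genus periods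
# (door D-CN-6 at `k = 1`; p2-lead T-54, QUEUE v3 (ii-b))

HONEST FRAMING (sub-lane «bsd-p2», run/shared/lean/b2b/bsd-rank1-residual/p2/, verbatim in every
file): the target of record is the FULL Birch–Swinnerton-Dyer formula for EVERY analytic-rank `≤ 1`
`E/ℚ` at ALL primes INCLUDING `2`; the odd-prime class ledger is referee A's; the `2`-part is OPEN
(cells O1 = X5 ∖ CM and O12 = the CM corner) and under census by «bsd-p2». Census / instrument
output at `2` = EVIDENCE / conjecture items with held-out validation, NEVER a Literature fact;
certificates close PAIRS (one isogeny class, `p = 2`), never classes. This file asserts NO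
arithmetic fact. WHAT IT DOES. For a prime `q ≡ 7 (mod 8)` (`E_q : y² = x³ − q²x`, conductor `32q²`,
root number `−1`): (i) `ρ(q) = 0` is p2-monsky-lit's THEOREM `FaulknerJames2007.rhoIndex_eq_one_of_prime`
(p323285) — certificate-free; (ii) the only decomposition of `q` is `{q}`, so Tian–Yuan–Zhang's first
genus sum is `Σ₁ = g(q) = #2Cl(ℚ(√−q))`, ODD because `disc ℚ(√−q) = −q` has ONE prime factor
(Rédei–Reichardt at `t = 1`, displayed fact `hR`; §1); (iii) hence TYZ Thm 1.2 (displayed fact `h12`,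
AS PRINTED by p2-lit-1) at `ρ = 0` gives `ord_{s=1} L(E_q, s) = 1` and
`L′(E_q,1) = 2^{−1}·𝓛²·Ω(E_q)·Reg(E_q)` with `𝓛` odd (`rankOneDatum_of_index_eq_one`, p322630) — the
rank-one datum `x = 𝓛²/2`, `ord₂ x = −1`, with NO L-value computed; (iv) `q = p₇` is in Monsky's 1990
Cor 5.15 family (1) (displayed fact `h515`, lit-2 p319203: rank `1`, `#Sel₂ = 8`, `Ш[2^∞] = 0`), so the
D-CN-5 door `bsdp_two_congruentNumberCurve_iff_of_cor515` (p320819; NO Gross–Zagier–Kolyvagin, no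
Monsky-1994 matrix) yields `BSD(E_q, 2) ⟺ ord₂ ∏c_ℓ(E_q) = 3`. `#E_q(ℚ)_tor = 4` and
`∏c_ℓ(E_q) = 8` are lit-1's THEOREMS `torsionOrder_congruentNumberCurve` (p323719) and
`tamagawaProduct_congruentNumberCurve_of_odd` (p324736: `c₂ = 2`, `c_p = 4`, Tate's algorithm in the
kernel) — NOTHING per-curve is displayed any more. CONCLUSION (§2): `∀ q prime, q ≡ 7 (mod 8) →
BSD(E_q, 2)` modulo exactly {TYZ Thm 1.2, Rédei–Reichardt, Monsky 1990 Cor 5.15}. §0 records the same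
discharge for the general door: `bsdp_two_congruentNumberCurve_of_genus'` = D-CN-6 with torsion and
Tamagawa supplied by the theorems (inputs: the named facts, the Monsky kernel count, `ρ = 0`, the genus
parity — all per-`n` DECIDABLE or theorems). NEW IN
THE TREE: the D-CN-5 pilot (p321997) displayed the census datum `x = 1/2` for the primes 7, 23, 31, 47,
71, 79, 103; here `x` is a theorem for ALL `q ≡ 7 (mod 8)`. A FAMILY of pairs in the OPEN cell
`openO12`, kernel-closed modulo displayed facts — not a class closure of the cell (CM corner, `p = 2`).
Nothing booked; no mark moved. Unit `b2b-bsdres-p2-typer` GEN 4 (p2-lead T-54); NEW file.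

References: [TianYuanZhang2017] Thm 1.2, §1; [Monsky1990MockHeegner] Cor 5.15 (1); [LiMa2008] Thm 0.4;
[FaulknerJames2007] Thm 1.2 (2); [SilvermanATAEC1994] IV.9 Table 4.1; [Knapp1993] Thm 5.2;
[Miller2011LMS] Def 1.1; HOME/p2/LEAD-OKS.md T-54, T-62, T-68. RE-KEY (append §3, T-81/T-84):
`bsdp_two_congruentNumberCurve_of_genus''` / `…_prime_seven_mod_eight'` are the twins keyed to the
corrected fact `thm12_parity_of_scriptL'` (ERRATUM F-Σ2); the §0/§2 originals carry the mis-stated one.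
-/

noncomputable section

open scoped Classical

open Matrix Finset WeierstrassCurve NumberField Literature.NumberTheory.EllipticCurves
  Literature.NumberTheory.EllipticCurves.Rank1Residual
  Literature.NumberTheory.EllipticCurves.Rank1Residual.Typed
  Literature.NumberTheory.EllipticCurves.Monsky1990
  Literature.NumberTheory.EllipticCurves.HeathBrown1994
  Literature.NumberTheory.EllipticCurves.TianYuanZhang2017
  Literature.NumberTheory.EllipticCurves.FaulknerJames2007
  Literature.NumberTheory.QuadraticFields.RedeiReichardt

set_option autoImplicit false

namespace Summit.BirchSwinnertonDyer.Rank1Residual.P2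

/-! ## §0 The door with NOTHING displayed: torsion and Tamagawa by lit-1's theorems -/

section Closed

variable {k : ℕ} (p : Fin k → ℕ)

/-- `∏_ℓ c_ℓ(E_n) = 2^{2k+1}` for `n = p₁⋯p_k` with distinct ODD primes (lit-1's
`tamagawaProduct_congruentNumberCurve_of_odd` on a product tuple: `c₂ = 2`, `c_{pᵢ} = 4`).
[cite: SilvermanATAEC1994, IV.9.4 Steps 4 and 6, Table 4.1 (PDF pp. 344–345)] -/
theorem tamagawaProduct_congruentNumberCurve_prod (hp : ∀ i, (p i).Prime) (hodd : ∀ i, Odd (p i))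
    (hinj : Function.Injective p) {n : ℕ} (hn : ∏ i, p i = n) :
    (congruentNumberCurve n).tamagawaProduct = 2 ^ (2 * k + 1) := by
  subst hn
  have hprod : ∏ i, p i = ∏ q ∈ univ.image p, q := by
    rw [Finset.prod_image fun i _ j _ h => hinj h]
  have hpf : (∏ i, p i).primeFactors = univ.image p := by
    rw [hprod, Nat.primeFactors_prod]
    simpa using fun i => hp i
  rw [tamagawaProduct_congruentNumberCurve_of_odd (squarefree_prod_of_injective p hp hinj)
    (Finset.prod_induction _ Odd (fun a b ha hb => ha.mul hb) odd_one fun i _ => hodd i), hpf,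
    Finset.card_image_of_injective _ hinj, Finset.card_univ, Fintype.card_fin]

/-- **DOOR D-CN-6 WITH NOTHING DISPLAYED.** As `bsdp_two_congruentNumberCurve_of_genus` (p324598), with
`#E_n(ℚ)_tor = 4` and `∏c_ℓ(E_n) = 2^{2k+1}` supplied by lit-1's THEOREMS (p323719, p324736): for
`n = p₁⋯p_k` (distinct odd primes), `n ≡ 5, 7 (mod 8)`, Monsky kernel count `2` (`s(n) = 1`),
`ρ(n) = 0` and an odd genus sum, `BSD(E_n, 2)` — modulo the displayed facts `h12` (TYZ Thm 1.2), `hGZK`,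
`hM` (Monsky 1994) and nothing else. [cite: TianYuanZhang2017, Thm. 1.2 and §1 (1.1)]
[cite: Miller2011LMS, Def. 1.1 (arXiv:1010.2431 p. 3)] -/
theorem bsdp_two_congruentNumberCurve_of_genus' (h12 : thm12_parity_of_scriptL)
    (hGZK : rank_eq_analyticRank_of_analyticRank_le_one) (hM : monsky_card_selmerGroup_two_odd)
    (hp : ∀ i, (p i).Prime) (hodd : ∀ i, Odd (p i)) (hinj : Function.Injective p)
    {n : ℕ} (hn : ∏ i, p i = n) (h8 : n % 8 = 5 ∨ n % 8 = 7)
    (L : Fin k → Fin k → ZMod 2) (d2 dm2 : Fin k → ZMod 2)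
    (hL : ∀ i j, addLegendreSym (p j) (p i) = L i j) (h2 : ∀ i, addLegendreSym 2 (p i) = d2 i)
    (hm2 : ∀ i, addLegendreSym (-2) (p i) = dm2 i)
    (hker : Fintype.card {v : Fin k ⊕ Fin k → ZMod 2 // Matrix.fromBlocks
        (Matrix.of (fun i j => if i = j then ∑ l ∈ Finset.univ.erase i, L i l else L i j) +
          Matrix.diagonal d2) (Matrix.diagonal d2) (Matrix.diagonal d2)
        (Matrix.of (fun i j => if i = j then ∑ l ∈ Finset.univ.erase i, L i l else L i j) +
          Matrix.diagonal dm2) *ᵥ v = 0} = 2)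
    (hρ : (rhoSubgroup n).index = 1)
    (hgen : Odd (genusSum₁ n fun d => genusClassNumber (GenusField d)) ∨
      Odd (genusSum₂ n fun d => genusClassNumber (GenusField d))) :
    BSDp (congruentNumberCurve n) 2 :=
  bsdp_two_congruentNumberCurve_of_genus p h12 hGZK hM hp hodd hinj hn h8 L d2 dm2 hL h2 hm2 hker hρ hgen
    (torsionOrder_congruentNumberCurve (hn ▸ squarefree_prod_of_injective p hp hinj))
    (tamagawaProduct_congruentNumberCurve_prod p hp hodd hinj hn) rfl

end Closed

/-! ## §1 The genus sum of a prime: `Σ₁(q) = g(q)`, odd for `q ≡ 3 (mod 4)` -/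

/-- The only non-ordered decomposition of a prime `q` into coprime factors `> 1` is `{q}`.
[cite: TianYuanZhang2017, Thm. 1.1 ("all decompositions … are non-ordered with dᵢ > 1")] -/
theorem decompositions_prime {q : ℕ} (hq : q.Prime) : decompositions q = {{q}} := by
  ext D
  simp only [decompositions, Finset.mem_filter, Finset.mem_powerset, hq.divisors,
    Finset.mem_singleton]
  constructor
  · rintro ⟨hsub, hgt, -, hprod⟩
    have hD : D ⊆ {q} := by
      intro d hd
      have h1 : d ≠ 1 := fun h => by have := hgt d hd; omega
      have : d ∈ ({1, q} : Finset ℕ) := hsub hd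
      simp only [Finset.mem_insert, Finset.mem_singleton] at this
      rcases this with h | h
      · exact absurd h h1
      · exact Finset.mem_singleton.mpr h
    rcases Finset.subset_singleton_iff.mp hD with h | h
    · subst h
      simp at hprod
      exact absurd hprod.symm hq.one_lt.ne'
    · exact h
  · rintro rfl
    refine ⟨by simp, fun d hd => ?_, by simp, by simp⟩
    rw [Finset.mem_singleton.mp hd]
    exact hq.one_lt

/-- For a prime `q`, `Σ₁(q; g) = g(q)` (the single decomposition `{q}` has at most one factor
`≢ 1 (mod 8)`). [cite: TianYuanZhang2017, Thm. 1.2 (Σ₁)] -/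
theorem genusSum₁_prime {q : ℕ} (hq : q.Prime) (g : ℕ → ℕ) : genusSum₁ q g = g q := by
  unfold genusSum₁
  rw [decompositions_prime hq, Finset.filter_singleton, if_pos, Finset.sum_singleton,
    Finset.prod_singleton]
  calc (({q} : Finset ℕ).filter fun d => d % 8 ≠ 1).card ≤ ({q} : Finset ℕ).card :=
        Finset.card_filter_le _ _
    _ = 1 := Finset.card_singleton q

/-- **`g(q) = #2Cl(ℚ(√−q))` is odd for a prime `q ≡ 3 (mod 4)`**, modulo Rédei–Reichardt: the
discriminant `−q` has the single prime factor `q` (`t = 1`), so `r₄ = t − 1 − rank = 0`.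
[cite: LiMa2008, Thm. 0.4 (p. 280) with Lemma 0.1] [cite: TianYuanZhang2017, §1 (p0002 L78–L82: g(d))] -/
theorem odd_genusClassNumber_genusField_prime (hR : redeiReichardt_fourTwoCard_classGroup) {q : ℕ}
    (hq : q.Prime) (h4 : q % 4 = 3) : Odd (genusClassNumber (GenusField q)) := by
  have hprod : ∏ i, (![q] : Fin 1 → ℕ) i = if q % 4 = 1 then 2 * q else q := by
    rw [if_neg (by omega)]; simp
  rw [odd_genusClassNumber_iff_of_redeiReichardt hR (p := ![q]) (fun i => by fin_cases i; exact hq)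
    (fun i j _ => Subsingleton.elim i j) hprod (GenusField q)
    (isQuadraticFieldOfSqrt_genusField hq.one_lt.le)]
  omega

/-- For a prime `q ≡ 3 (mod 4)` the genus condition of TYZ Thm 1.2 holds for `K_d = GenusField d`:
`Σ₁(q) = g(q)` is odd. [cite: TianYuanZhang2017, Thm. 1.2 (Σ₁)] [cite: LiMa2008, Thm. 0.4] -/
theorem odd_genusSum₁_genusField_prime (hR : redeiReichardt_fourTwoCard_classGroup) {q : ℕ}
    (hq : q.Prime) (h4 : q % 4 = 3) :
    Odd (genusSum₁ q fun d => genusClassNumber (GenusField d)) := by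
  rw [genusSum₁_prime hq]
  exact odd_genusClassNumber_genusField_prime hR hq h4

/-! ## §2 The family theorem -/

/-- `2k(q) − 2 − a(q) = −1` for an odd prime `q`. [cite: TianYuanZhang2017, §1 (p0002 L63–L65: k(n), a(n))] -/
theorem twoExponent_prime {q : ℕ} (hq : q.Prime) (hodd : Odd q) : twoExponent q = -1 := by
  have h := twoExponent_prod_eq (![q] : Fin 1 → ℕ) (fun i => by fin_cases i; exact hq)
    (fun i => by fin_cases i; exact hodd) (fun i j _ => Subsingleton.elim i j)
  simp only [Fin.prod_univ_one, Matrix.cons_val_fin_one, Nat.cast_one] at h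
  rw [h]; norm_num

/-- **THE PRIME FAMILY `q ≡ 7 (mod 8)`.** For a prime `q ≡ 7 (mod 8)`: `ord_{s=1} L(E_q, s) = 1` and
`BSD(E_q, 2)`, modulo the displayed facts `h12` (Tian–Yuan–Zhang Thm 1.2), `hR` (Rédei–Reichardt) and
`h515` (Monsky 1990 Cor 5.15 (1): `q = p₇`) — nothing per-curve displayed. Route: `ρ(q) = 0`
(`rhoIndex_eq_one_of_prime`, a theorem), `Σ₁(q) = g(q)` odd (§1) ⇒ TYZ: `r_an = 1`,
`L′(E_q,1) = 2^{−1}𝓛²·Ω·Reg`, `𝓛` odd ⇒ D-CN-5 door (`bsdp_two_congruentNumberCurve_iff_of_cor515`: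
rank `1`, `Ш[2^∞] = 0` from Cor 5.15; no GZK) ⇒ `BSD(E_q, 2) ⟺ ord₂ ∏c_ℓ(E_q) = 3`, and
`∏c_ℓ(E_q) = 8` (lit-1's Tamagawa theorem), torsion `= 4` (lit-1's theorem).
[cite: TianYuanZhang2017, Thm. 1.2 and §1 (1.1)] [cite: Monsky1990MockHeegner, Cor. 5.15 (1) (p. 66)]
[cite: Miller2011LMS, Def. 1.1 (arXiv:1010.2431 p. 3)] -/
theorem bsdp_two_congruentNumberCurve_prime_seven_mod_eight (h12 : thm12_parity_of_scriptL)
    (hR : redeiReichardt_fourTwoCard_classGroup) (h515 : cor515_rank_eq_one_and_card_selmerGroup_two)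
    {q : ℕ} (hq : q.Prime) (h8 : q % 8 = 7) :
    haveI := isElliptic_congruentNumberCurve hq.ne_zero
    (congruentNumberCurve q).analyticRank = 1 ∧ BSDp (congruentNumberCurve q) 2 := by
  haveI := isElliptic_congruentNumberCurve hq.ne_zero
  haveI : Fact (Nat.Prime 2) := ⟨Nat.prime_two⟩
  have hsq : Squarefree q := hq.squarefree
  have hqodd : Odd q := Nat.odd_iff.mpr (by omega)
  have hN : IsCor515Family q := Or.inl ⟨hq, Or.inr h8⟩
  have hρ : (rhoSubgroup q).index = 1 := rhoIndex_eq_one_of_prime hq (Or.inr h8)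
  obtain ⟨Lz, hLodd, hr1, hderiv⟩ := rankOneDatum_of_index_eq_one h12 hsq (Or.inr h8) hρ GenusField
    (isGenusFieldFamily_genusField q) (Or.inl (odd_genusSum₁_genusField_prime hR hq (by omega)))
  have hx : deriv (congruentNumberCurve q).entireLFunction 1 =
      (((2 : ℚ) ^ twoExponent q * (Lz : ℚ) ^ 2 : ℚ) : ℂ) *
        ((congruentNumberCurve q).realPeriodRat : ℂ) * ((congruentNumberCurve q).regulator : ℂ) := by
    rw [hderiv]; push_cast; ring
  have hx0 : (2 : ℚ) ^ twoExponent q * (Lz : ℚ) ^ 2 ≠ 0 := by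
    have hL0' : Lz ≠ 0 := fun h => by simp [h] at hLodd
    have hL0 : (Lz : ℚ) ≠ 0 := by exact_mod_cast hL0'
    exact mul_ne_zero (zpow_ne_zero _ two_ne_zero) (pow_ne_zero _ hL0)
  obtain ⟨-, hiff⟩ := bsdp_two_congruentNumberCurve_iff_of_cor515 h515 hN
    (torsionOrder_congruentNumberCurve hsq) hx0 hx
  refine ⟨hr1, hiff.mpr ?_⟩
  rw [padicValRat_two_zpow_mul_sq hLodd, twoExponent_prime hq hqodd,
    tamagawaProduct_congruentNumberCurve_of_odd hsq hqodd, hq.primeFactors, Finset.card_singleton,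
    padicValNat.prime_pow]
  norm_num

/-- **THE PRIME FAMILY `q ≡ 7 (mod 8)`: `BSD(E_q, 2)` for EVERY prime `q ≡ 7 (mod 8)`**, modulo the
displayed facts `h12`, `hR`, `h515` — one uniform kernel theorem with NO per-curve input: no
certificate, no L-value, no torsion / Tamagawa datum (both are lit-1's theorems).
[cite: TianYuanZhang2017, Thm. 1.2 and §1 (1.1)] [cite: Monsky1990MockHeegner, Cor. 5.15 (1) (p. 66)]
[cite: FaulknerJames2007, Thm. 1.2 (2)] [cite: Miller2011LMS, Def. 1.1 (arXiv:1010.2431 p. 3)] -/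
theorem forall_bsdp_two_congruentNumberCurve_prime_seven_mod_eight (h12 : thm12_parity_of_scriptL)
    (hR : redeiReichardt_fourTwoCard_classGroup) (h515 : cor515_rank_eq_one_and_card_selmerGroup_two) :
    ∀ q : ℕ, q.Prime → q % 8 = 7 → BSDp (congruentNumberCurve q) 2 :=
  fun _ hq h8 => (bsdp_two_congruentNumberCurve_prime_seven_mod_eight h12 hR h515 hq h8).2


/-! ## §3 RE-KEY (APPEND-ONLY, p2-typer GEN 4, ruling T-81 / T-84): the closed door and the prime family keyed to Thm 1.2 AS PRINTED

ERRATUM F-Σ2: the GEN-1 fact `thm12_parity_of_scriptL` is MIS-STATED (its `Σ₂` omits the `ℓ = 0` term);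
the §0/§2 theorems above are KEPT but should no longer be consumed.  The twins below take lit-1's
corrected fact `thm12_parity_of_scriptL'` (`rankOneDatum_of_index_eq_one'`) and the re-keyed door
`bsdp_two_congruentNumberCurve_iff_of_genus'` (`P2/CongruentNumberPairsAtTwoRankOneGenus.lean` §3);
the prime family feeds `Σ₁`, so its statement is otherwise verbatim. -/

section Printed

variable {k : ℕ} (p : Fin k → ℕ)

/-- **DOOR D-CN-6 WITH NOTHING DISPLAYED, KEYED TO TYZ Thm 1.2 AS PRINTED** (twin of
`bsdp_two_congruentNumberCurve_of_genus'` with `h12 : thm12_parity_of_scriptL'` and genus hypothesis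
`Σ₁` odd or `Σ₂'` odd): for `n = p₁⋯p_k` (distinct odd primes), `n ≡ 5, 7 (mod 8)`, Monsky kernel count
`2`, `ρ(n) = 0` and an odd genus sum, `BSD(E_n, 2)` — modulo `h12`, `hGZK`, `hM` and nothing else
(torsion p323719, Tamagawa p324736 by name). [cite: TianYuanZhang2017, Thm. 1.2 and §1 (1.1); proof of Prop. 3.4 (p0016 L146)]
[cite: Miller2011LMS, Def. 1.1 (arXiv:1010.2431 p. 3)] -/
theorem bsdp_two_congruentNumberCurve_of_genus'' (h12 : thm12_parity_of_scriptL')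
    (hGZK : rank_eq_analyticRank_of_analyticRank_le_one) (hM : monsky_card_selmerGroup_two_odd)
    (hp : ∀ i, (p i).Prime) (hodd : ∀ i, Odd (p i)) (hinj : Function.Injective p)
    {n : ℕ} (hn : ∏ i, p i = n) (h8 : n % 8 = 5 ∨ n % 8 = 7)
    (L : Fin k → Fin k → ZMod 2) (d2 dm2 : Fin k → ZMod 2)
    (hL : ∀ i j, addLegendreSym (p j) (p i) = L i j) (h2 : ∀ i, addLegendreSym 2 (p i) = d2 i)
    (hm2 : ∀ i, addLegendreSym (-2) (p i) = dm2 i)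
    (hker : Fintype.card {v : Fin k ⊕ Fin k → ZMod 2 // Matrix.fromBlocks
        (Matrix.of (fun i j => if i = j then ∑ l ∈ Finset.univ.erase i, L i l else L i j) +
          Matrix.diagonal d2) (Matrix.diagonal d2) (Matrix.diagonal d2)
        (Matrix.of (fun i j => if i = j then ∑ l ∈ Finset.univ.erase i, L i l else L i j) +
          Matrix.diagonal dm2) *ᵥ v = 0} = 2)
    (hρ : (rhoSubgroup n).index = 1)
    (hgen : Odd (genusSum₁ n fun d => genusClassNumber (GenusField d)) ∨
      Odd (genusSum₂' n fun d => genusClassNumber (GenusField d))) :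
    BSDp (congruentNumberCurve n) 2 := by
  haveI : Fact (Nat.Prime 2) := ⟨Nat.prime_two⟩
  refine (bsdp_two_congruentNumberCurve_iff_of_genus' p h12 hGZK hM hp hodd hinj hn h8 L d2 dm2 hL h2
    hm2 hker hρ hgen (torsionOrder_congruentNumberCurve (hn ▸ squarefree_prod_of_injective p hp hinj))).2.2.2.mpr ?_
  rw [tamagawaProduct_congruentNumberCurve_prod p hp hodd hinj hn, padicValNat.prime_pow]

/-- **THE PRIME FAMILY `q ≡ 7 (mod 8)`, KEYED TO TYZ Thm 1.2 AS PRINTED** (twin of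
`bsdp_two_congruentNumberCurve_prime_seven_mod_eight` with `h12 : thm12_parity_of_scriptL'`): for a prime
`q ≡ 7 (mod 8)`, `ord_{s=1} L(E_q, s) = 1` and `BSD(E_q, 2)`, modulo `h12`, `hR`, `h515` — nothing
per-curve displayed (rank one in print: Monsky 1990 Cor 5.15 (1) / Tian 2014 Thm 1.3 at `k = 0`; the
`2`-part asserted without proof in Tian, ICM 2022 p. 2000; proved here modulo the displayed facts).
[cite: TianYuanZhang2017, Thm. 1.2 and §1 (1.1); proof of Prop. 3.4 (p0016 L146)]
[cite: Monsky1990MockHeegner, Cor. 5.15 (1) (p. 66)] [cite: Miller2011LMS, Def. 1.1 (arXiv:1010.2431 p. 3)] -/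
theorem bsdp_two_congruentNumberCurve_prime_seven_mod_eight' (h12 : thm12_parity_of_scriptL')
    (hR : redeiReichardt_fourTwoCard_classGroup) (h515 : cor515_rank_eq_one_and_card_selmerGroup_two)
    {q : ℕ} (hq : q.Prime) (h8 : q % 8 = 7) :
    haveI := isElliptic_congruentNumberCurve hq.ne_zero
    (congruentNumberCurve q).analyticRank = 1 ∧ BSDp (congruentNumberCurve q) 2 := by
  haveI := isElliptic_congruentNumberCurve hq.ne_zero
  haveI : Fact (Nat.Prime 2) := ⟨Nat.prime_two⟩
  have hsq : Squarefree q := hq.squarefree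
  have hqodd : Odd q := Nat.odd_iff.mpr (by omega)
  have hN : IsCor515Family q := Or.inl ⟨hq, Or.inr h8⟩
  have hρ : (rhoSubgroup q).index = 1 := rhoIndex_eq_one_of_prime hq (Or.inr h8)
  obtain ⟨Lz, hLodd, hr1, hderiv⟩ := rankOneDatum_of_index_eq_one' h12 hsq (Or.inr h8) hρ GenusField
    (isGenusFieldFamily_genusField q) (Or.inl (odd_genusSum₁_genusField_prime hR hq (by omega)))
  have hx : deriv (congruentNumberCurve q).entireLFunction 1 =
      (((2 : ℚ) ^ twoExponent q * (Lz : ℚ) ^ 2 : ℚ) : ℂ) *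
        ((congruentNumberCurve q).realPeriodRat : ℂ) * ((congruentNumberCurve q).regulator : ℂ) := by
    rw [hderiv]; push_cast; ring
  have hx0 : (2 : ℚ) ^ twoExponent q * (Lz : ℚ) ^ 2 ≠ 0 := by
    have hL0' : Lz ≠ 0 := fun h => by simp [h] at hLodd
    have hL0 : (Lz : ℚ) ≠ 0 := by exact_mod_cast hL0'
    exact mul_ne_zero (zpow_ne_zero _ two_ne_zero) (pow_ne_zero _ hL0)
  obtain ⟨-, hiff⟩ := bsdp_two_congruentNumberCurve_iff_of_cor515 h515 hN
    (torsionOrder_congruentNumberCurve hsq) hx0 hx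
  refine ⟨hr1, hiff.mpr ?_⟩
  rw [padicValRat_two_zpow_mul_sq hLodd, twoExponent_prime hq hqodd,
    tamagawaProduct_congruentNumberCurve_of_odd hsq hqodd, hq.primeFactors, Finset.card_singleton,
    padicValNat.prime_pow]
  norm_num

/-- **`BSD(E_q, 2)` for EVERY prime `q ≡ 7 (mod 8)`, keyed to TYZ Thm 1.2 AS PRINTED** (twin of
`forall_bsdp_two_congruentNumberCurve_prime_seven_mod_eight`), modulo `h12`, `hR`, `h515`; no per-curve
input. [cite: TianYuanZhang2017, Thm. 1.2 and §1 (1.1)] [cite: Monsky1990MockHeegner, Cor. 5.15 (1) (p. 66)]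
[cite: FaulknerJames2007, Thm. 1.2 (2)] [cite: Miller2011LMS, Def. 1.1 (arXiv:1010.2431 p. 3)] -/
theorem forall_bsdp_two_congruentNumberCurve_prime_seven_mod_eight' (h12 : thm12_parity_of_scriptL')
    (hR : redeiReichardt_fourTwoCard_classGroup) (h515 : cor515_rank_eq_one_and_card_selmerGroup_two) :
    ∀ q : ℕ, q.Prime → q % 8 = 7 → BSDp (congruentNumberCurve q) 2 :=
  fun _ hq h8 => (bsdp_two_congruentNumberCurve_prime_seven_mod_eight' h12 hR h515 hq h8).2

end Printed

end Summit.BirchSwinnertonDyer.Rank1Residual.P2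

end
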